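import Summits.Ventures.PackingBounds.Configurations.Dim23Card552Data

/-!
# The 552-point sharp configuration (276 equiangular lines in `ℝ²³`, `Co₃`) as an explicit section of the Leech lattice: `A(23, arccos 1/5) = 552` and the ground-state energy on `S^22` — kernel checks, part B

Framing: lottery ticket; floor = certified bounds/negative ranges. Histogram chunks `12`–`24` of
the configuration of `Configurations/Dim23Card552Data` (see there and `Configurations/Dim23Card552`).
-/

namespace Summit.Ventures.PackingBounds.Config.Dim23Card552

open Summit.Ventures.PackingBounds.Config

set_option maxRecDepth 100000 in
/-- Kernel check (distance distribution), rows of chunk `12` against the whole configuration. -/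
theorem hist_12 : histOK vecs table vecs12 = true := by decide +kernel

set_option maxRecDepth 100000 in
/-- Kernel check (distance distribution), rows of chunk `13` against the whole configuration. -/
theorem hist_13 : histOK vecs table vecs13 = true := by decide +kernel

set_option maxRecDepth 100000 in
/-- Kernel check (distance distribution), rows of chunk `14` against the whole configuration. -/
theorem hist_14 : histOK vecs table vecs14 = true := by decide +kernel

set_option maxRecDepth 100000 in
/-- Kernel check (distance distribution), rows of chunk `15` against the whole configuration. -/
theorem hist_15 : histOK vecs table vecs15 = true := by decide +kernel

set_option maxRecDepth 100000 in
/-- Kernel check (distance distribution), rows of chunk `16` against the whole configuration. -/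
theorem hist_16 : histOK vecs table vecs16 = true := by decide +kernel

set_option maxRecDepth 100000 in
/-- Kernel check (distance distribution), rows of chunk `17` against the whole configuration. -/
theorem hist_17 : histOK vecs table vecs17 = true := by decide +kernel

set_option maxRecDepth 100000 in
/-- Kernel check (distance distribution), rows of chunk `18` against the whole configuration. -/
theorem hist_18 : histOK vecs table vecs18 = true := by decide +kernel

set_option maxRecDepth 100000 in
/-- Kernel check (distance distribution), rows of chunk `19` against the whole configuration. -/
theorem hist_19 : histOK vecs table vecs19 = true := by decide +kernel

set_option maxRecDepth 100000 in
/-- Kernel check (distance distribution), rows of chunk `20` against the whole configuration. -/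
theorem hist_20 : histOK vecs table vecs20 = true := by decide +kernel

set_option maxRecDepth 100000 in
/-- Kernel check (distance distribution), rows of chunk `21` against the whole configuration. -/
theorem hist_21 : histOK vecs table vecs21 = true := by decide +kernel

set_option maxRecDepth 100000 in
/-- Kernel check (distance distribution), rows of chunk `22` against the whole configuration. -/
theorem hist_22 : histOK vecs table vecs22 = true := by decide +kernel

set_option maxRecDepth 100000 in
/-- Kernel check (distance distribution), rows of chunk `23` against the whole configuration. -/
theorem hist_23 : histOK vecs table vecs23 = true := by decide +kernel

set_option maxRecDepth 100000 in
/-- Kernel check (distance distribution), rows of chunk `24` against the whole configuration. -/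
theorem hist_24 : histOK vecs table vecs24 = true := by decide +kernel

end Summit.Ventures.PackingBounds.Config.Dim23Card552
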